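import Summits.CriticalPhenomena.SAWScalingLimit.Theses.SAWLeftRightFKG
import Literature.Probability.RandomPlanarGeometry.CurveTraversalCompact
import Literature.Probability.Percolation.InterfaceScalingLimitProofs

/-!
# `SAWLeftRightFKG.SAWTraversalBound` (stmt-CriticalPhenomena-1880): logical status of the
Aizenman–Burchard hypothesis (H1) for the critical square-lattice SAW

Support file for the statement item `SAWTraversalBound` of route `SAWLeftRightFKG` (identical decl
text in routes `SAWTotalPositivity`, `SAWTargetMonotonicity`). The item is Aizenman–Burchard's
multiple-crossing hypothesis (H1) (Duke Math. J. 99 (1999), eq. (1.3)) for the law `SAW.law` of the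
critical self-avoiding walk in a Jordan Dobrushin domain, with a SHELL-DEPENDENT threshold
`k : ℂ → ℝ → ℝ → ℕ` chosen after the domain and the endpoint approximation. No annulus-crossing
technology for the critical planar SAW exists in print; what is certified here is the exact
logical weight of the item as typed:

* `sawTraversalBound_of_shellCountTight` — **quantile reduction**: because the threshold may depend
  on the shell while only `K ≥ 0`, `λ > 2` are fixed, the power `(ρ/R)^λ` carries NO information:
  (H1) already follows from UNIFORM-IN-MESH TIGHTNESS OF THE TRAVERSAL COUNTS, shell by shell
  (`∀ shell ∀ ε ∃ k ∀ δ ≤ min ρ δ₀, P_δ(k traversals) ≤ ε`), with `K = 1`, `λ = 3` and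
  `k(x, ρ, R) :=` the `(ρ/R)³`-quantile.
* `hasTraversals_toCurve_le` — the lattice short-distance count: the polyline of ANY graph walk
  traverses a genuine shell at most `2 (#support-tail + 1)` times (order-connected pieces of the time
  spent in the inner ball, `Percolation.le_of_hasTraversals_of_hasOrdConnectedCover`).
* `shellCountTight_of_eventualTight`, `sawTraversalBound_of_eventualTight` — **(H1) ⟸ eventual
  tightness** (`EventualTight`, stmt-CriticalPhenomena-1881): on the compact set carrying all but `ε`
  of the mass every genuine shell is traversed boundedly often
  (`CurveClass.exists_not_hasTraversals_of_isCompact`), and at meshes `δ ≥ δ₁` bounded away from `0`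
  the event is EMPTY by the short-distance count (a self-avoiding walk of `Ω_δ` has at most
  `#(box of radius ⌈r/δ₁⌉)` steps). Together with the route's glue item `TraversalBoundTight`
  (stmt-1882: (H1) ⟹ `EventualTight`, the tree's PROVED Aizenman–Burchard criterion), the items 1880 and
  1881 are EQUIVALENT (`sawTraversalBound_iff_eventualTight_of_glue`): (H1) as typed is precisely the
  open precompactness problem for the critical SAW — neither weaker nor stronger.

Nothing here uses a named fact; axioms are the standard three.
-/

noncomputable section

open MeasureTheory Filter Topology Set Metric
open Literature.Probability.RandomPlanarGeometry Literature.Probability.LatticeModels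
open Literature.Probability.Percolation
open Summit.CriticalPhenomena.SAWScalingLimit.Theses.SAWLeftRightFKG
open scoped ENNReal unitInterval

namespace Summit.CriticalPhenomena.SAWScalingLimit.Theorems

/-! ### Quantile reduction: the exponent is illusory with a shell-dependent threshold -/

/-- **Quantile reduction.** If for every Dobrushin domain and endpoint approximation there is
`δ₀ > 0` such that for every genuine shell `D(x; ρ, R)`, `0 < ρ < R ≤ 1`, and every `ε > 0` ONE
threshold `k` makes `k` separate traversals of the shell by the mesh polyline of the critical SAW
have probability `≤ ε` at EVERY mesh `δ ≤ min ρ δ₀` (uniform-in-mesh tightness of the traversal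
counts, shell by shell — no rate in `ρ/R`), then `SAWTraversalBound` holds, with `K = 1`, `λ = 3`
and the shell-dependent threshold `k(x, ρ, R) :=` the `(ρ/R)³`-quantile. (Aizenman–Burchard 1999,
(1.3), read with the tree's free threshold.) [folklore] -/
theorem sawTraversalBound_of_shellCountTight
    (h : ∀ (D : DobrushinDomain) (a b : ℝ → Site 2), SAW.IsEndpointApprox D a b →
      ∃ δ₀ : ℝ, 0 < δ₀ ∧ ∀ (x : ℂ) (ρ R : ℝ), 0 < ρ → ρ < R → R ≤ 1 → ∀ ε : ℝ≥0∞, 0 < ε →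
        ∃ k : ℕ, ∀ δ ∈ Set.Ioc (0 : ℝ) δ₀, δ ≤ ρ →
          SAW.law D.carrier δ (a δ) (b δ)
              {γ | (⟨γ.walk.toCurve (meshPoint δ)⟩ : Curve ℂ).HasTraversals k x ρ R} ≤ ε) :
    SAWTraversalBound := by
  classical
  intro D a b hab
  obtain ⟨δ₀, hδ₀, hsh⟩ := h D a b hab
  have hk : ∀ (x : ℂ) (ρ R : ℝ), ∃ k : ℕ, 0 < ρ → ρ < R → R ≤ 1 →
      ∀ δ ∈ Set.Ioc (0 : ℝ) δ₀, δ ≤ ρ →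
        SAW.law D.carrier δ (a δ) (b δ)
            {γ | (⟨γ.walk.toCurve (meshPoint δ)⟩ : Curve ℂ).HasTraversals k x ρ R}
          ≤ ENNReal.ofReal ((ρ / R) ^ (3 : ℝ)) := by
    intro x ρ R
    by_cases hc : 0 < ρ ∧ ρ < R ∧ R ≤ 1
    · have hpos : 0 < ENNReal.ofReal ((ρ / R) ^ (3 : ℝ)) :=
        ENNReal.ofReal_pos.2 (Real.rpow_pos_of_pos (div_pos hc.1 (hc.1.trans hc.2.1)) _)
      obtain ⟨k, hk⟩ := hsh x ρ R hc.1 hc.2.1 hc.2.2 _ hpos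
      exact ⟨k, fun _ _ _ => hk⟩
    · exact ⟨0, fun h1 h2 h3 => absurd ⟨h1, h2, h3⟩ hc⟩
  choose k hk using hk
  refine ⟨k, 1, 3, δ₀, zero_le_one, by norm_num, hδ₀, ?_⟩
  intro δ hδ x ρ R hδρ hρR hR1
  have hρ : 0 < ρ := hδ.1.trans_le hδρ
  simpa only [one_mul] using hk x ρ R hρ hρR hR1 δ hδ hδρ

/-! ### The lattice short-distance count for the polyline of a walk -/

/-- At most as many segments of a polyline meet a set as there are segments. [folklore] -/
theorem segMeetCount_le_length {V : Type*} [NormedAddCommGroup V] [NormedSpace ℝ V]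
    (C : Set V) (a : V) (l : List V) : segMeetCount C a l ≤ l.length := by
  classical
  induction l generalizing a with
  | nil => exact Nat.le_refl _
  | cons b l ih =>
    change (if (segment ℝ a b ∩ C).Nonempty then 1 else 0) + segMeetCount C b l ≤ (b :: l).length
    have := ih b
    rw [List.length_cons]
    split_ifs <;> omega

/-- **Short-distance count.** The polyline of a walk `w` of ANY graph, through the embedded vertices
of its support, traverses a genuine shell `D(x; ρ, R)`, `ρ < R`, at most `2 (#tail of the support + 1)`
times: the times it spends in the convex ball `B̄(x, ρ)` are covered by at most one interval per
segment plus the constant tail of the dyadic clock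
(`Percolation.hasOrdConnectedCover_preimage_polylineFrom`), and each piece carries at most two separate
traversals (`Percolation.le_of_hasTraversals_of_hasOrdConnectedCover`). (Aizenman–Burchard 1999, §1.a,
"short-distance cutoff", made quantitative.) [folklore] -/
theorem hasTraversals_toCurve_le {V : Type*} {G : SimpleGraph V} {u v : V} (emb : V → ℂ)
    (w : G.Walk u v) {x : ℂ} {ρ R : ℝ} (hρR : ρ < R) {k : ℕ}
    (hk : (⟨w.toCurve emb⟩ : Curve ℂ).HasTraversals k x ρ R) :
    k ≤ 2 * (w.support.tail.length + 1) := by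
  obtain ⟨l, hl⟩ : ∃ l, w.support = u :: l := ⟨_, w.cons_tail_support.symm⟩
  have htail : w.support.tail = l := by rw [hl]; rfl
  rw [htail]
  have hcurve : (⟨w.toCurve emb⟩ : Curve ℂ) =
      ⟨(polylineFrom (emb u) (l.map emb)).2.toContinuousMap⟩ := by
    rw [SimpleGraph.Walk.toCurve, hl]
    rfl
  rw [hcurve] at hk
  have hcov := hasOrdConnectedCover_preimage_polylineFrom (convex_closedBall x ρ) (emb u) (l.map emb)
  have hle := le_of_hasTraversals_of_hasOrdConnectedCover
    (γ := (⟨(polylineFrom (emb u) (l.map emb)).2.toContinuousMap⟩ : Curve ℂ)) hρR hcov hk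
  have hseg := segMeetCount_le_length (closedBall x ρ) (emb u) (l.map emb)
  rw [List.length_map] at hseg
  calc k ≤ 2 * (segMeetCount (closedBall x ρ) (emb u) (l.map emb) + 1) := hle
    _ ≤ 2 * (l.length + 1) := by gcongr

/-- The tail of the support of a walk of the discrete domain `Ω_δ` lies in the discrete domain (every
vertex after the first is the head of a dart, and darts of `Ω_δ` join vertices of `meshDomain Ω δ`).
[folklore] -/
theorem mem_meshDomain_of_mem_support_tail {Ω : Set ℂ} {δ : ℝ} {u v : Site 2}
    (w : (discreteDomainGraph Ω δ).Walk u v) {y : Site 2} (hy : y ∈ w.support.tail) :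
    y ∈ meshDomain Ω δ := by
  rw [← SimpleGraph.Walk.map_snd_darts] at hy
  obtain ⟨d, -, rfl⟩ := List.mem_map.1 hy
  exact (discreteDomainGraph_adj_iff.1 d.adj).2.2

/-- **Uniform step bound at meshes bounded below.** If `Ω ⊆ B̄(0, r)` and `0 < δ₁ ≤ δ`, the support
tail of a self-avoiding walk of `Ω_δ` has at most `#([-⌈r/δ₁⌉, ⌈r/δ₁⌉]²)` vertices: they are
distinct sites of `meshDomain Ω δ ⊆ {y | δ y ∈ Ω}`. [folklore] -/
theorem length_support_tail_le {Ω : Set ℂ} {r δ₁ δ : ℝ} (hΩ : Ω ⊆ closedBall (0 : ℂ) r)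
    (hδ₁ : 0 < δ₁) (hδ : δ₁ ≤ δ) {u v : Site 2} (w : (discreteDomainGraph Ω δ).Walk u v)
    (hw : w.IsPath) :
    w.support.tail.length ≤
      (Fintype.piFinset fun _ : Fin 2 => Finset.Icc (-⌈r / δ₁⌉) ⌈r / δ₁⌉).card := by
  classical
  set B : Finset (Site 2) := Fintype.piFinset fun _ : Fin 2 => Finset.Icc (-⌈r / δ₁⌉) ⌈r / δ₁⌉
  have hδ0 : 0 < δ := hδ₁.trans_le hδ
  have hnd : w.support.tail.Nodup := hw.support_nodup.sublist (List.tail_sublist _)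
  have hsub : w.support.tail.toFinset ⊆ B := by
    intro y hy
    rw [List.mem_toFinset] at hy
    have hyD := mem_meshDomain_of_mem_support_tail w hy
    have hyΩ : meshPoint δ y ∈ Ω := meshDomain_subset_meshVertices Ω δ hyD
    have hnorm : ‖meshPoint δ y‖ ≤ r := by simpa using hΩ hyΩ
    have hr0 : 0 ≤ r := (norm_nonneg _).trans hnorm
    have key : ∀ c : ℤ, |δ * (c : ℝ)| ≤ r → c ∈ Finset.Icc (-⌈r / δ₁⌉) ⌈r / δ₁⌉ := by
      intro c hc
      rw [abs_mul, abs_of_pos hδ0] at hc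
      have h1 : |(c : ℝ)| ≤ r / δ := by rw [le_div_iff₀ hδ0, mul_comm]; exact hc
      have h2 : r / δ ≤ r / δ₁ := div_le_div_of_nonneg_left hr0 hδ₁ hδ
      have h3 : r / δ₁ ≤ (⌈r / δ₁⌉ : ℝ) := Int.le_ceil _
      obtain ⟨hlo, hhi⟩ := abs_le.1 (h1.trans (h2.trans h3))
      refine Finset.mem_Icc.2 ⟨?_, ?_⟩
      · exact_mod_cast hlo
      · exact_mod_cast hhi
    rw [Fintype.mem_piFinset]
    intro i
    fin_cases i
    · have := (Complex.abs_re_le_norm (meshPoint δ y)).trans hnorm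
      rw [meshPoint_re] at this
      exact key _ this
    · have := (Complex.abs_im_le_norm (meshPoint δ y)).trans hnorm
      rw [meshPoint_im] at this
      exact key _ this
  calc w.support.tail.length = w.support.tail.toFinset.card := (List.toFinset_card_of_nodup hnd).symm
    _ ≤ B.card := Finset.card_le_card hsub

/-! ### (H1) from eventual tightness -/

/-- **Tightness ⟹ uniform-in-mesh tightness of the traversal counts, shell by shell** (with
`δ₀ = 1`). Given a shell `D(x; ρ, R)` and `ε > 0`: eventual tightness of the SAW laws gives a compact
`𝒦 ⊆ CurveClass ℂ` and `δ₁ > 0` with `P_δ(curve ∉ 𝒦) ≤ ε` for `δ < δ₁`; on `𝒦` the shell is traversed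
fewer than `k₁` times (`CurveClass.exists_not_hasTraversals_of_isCompact`); and at meshes
`δ ∈ [δ₁, 1]` NO self-avoiding walk of `Ω_δ` traverses it `k₂ = 2 (#box + 1) + 1` times
(`hasTraversals_toCurve_le`, `length_support_tail_le`), so the event is empty. Threshold `max k₁ k₂`.
(Aizenman–Burchard 1999, §1–§2: on compact families the crossing numbers are uniformly bounded.)
[folklore] -/
theorem shellCountTight_of_eventualTight (hT : EventualTight) :
    ∀ (D : DobrushinDomain) (a b : ℝ → Site 2), SAW.IsEndpointApprox D a b →
      ∃ δ₀ : ℝ, 0 < δ₀ ∧ ∀ (x : ℂ) (ρ R : ℝ), 0 < ρ → ρ < R → R ≤ 1 → ∀ ε : ℝ≥0∞, 0 < ε →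
        ∃ k : ℕ, ∀ δ ∈ Set.Ioc (0 : ℝ) δ₀, δ ≤ ρ →
          SAW.law D.carrier δ (a δ) (b δ)
              {γ | (⟨γ.walk.toCurve (meshPoint δ)⟩ : Curve ℂ).HasTraversals k x ρ R} ≤ ε := by
  classical
  intro D a b hab
  refine ⟨1, one_pos, ?_⟩
  intro x ρ R _hρ hρR _hR1 ε hε
  obtain ⟨𝒦, h𝒦, hev⟩ := hT D a b hab ε hε
  obtain ⟨δ₁, hδ₁, hsub⟩ := mem_nhdsGT_iff_exists_Ioo_subset.1 hev
  obtain ⟨k₁, hk₁⟩ := CurveClass.exists_not_hasTraversals_of_isCompact h𝒦 x hρR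
  obtain ⟨r, hr⟩ := (Metric.isBounded_iff_subset_closedBall (0 : ℂ)).1 D.isBounded
  set B : Finset (Site 2) := Fintype.piFinset fun _ : Fin 2 => Finset.Icc (-⌈r / δ₁⌉) ⌈r / δ₁⌉
  set k₂ : ℕ := 2 * (B.card + 1) + 1
  refine ⟨max k₁ k₂, fun δ hδ _hδρ => ?_⟩
  by_cases hsmall : δ < δ₁
  · -- tightness regime: the event lies in `{curve ∉ 𝒦}`
    have h1 : SAW.law D.carrier δ (a δ) (b δ)
        ((fun γ : SAW.DomainSAW D.carrier δ (a δ) (b δ) => γ.curve) ⁻¹' 𝒦ᶜ) ≤ ε :=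
      hsub ⟨hδ.1, hsmall⟩
    refine le_trans (measure_mono fun γ hγ => ?_) h1
    simp only [mem_setOf_eq] at hγ
    simp only [mem_preimage, mem_compl_iff]
    intro hK
    have hK' : CurveClass.mk (⟨γ.walk.toCurve (meshPoint δ)⟩ : Curve ℂ) ∈ 𝒦 := hK
    exact hk₁ _ hK' (hγ.of_le (le_max_left _ _))
  · -- large mesh: the event is empty
    have hδ₁δ : δ₁ ≤ δ := not_lt.1 hsmall
    have hempty : {γ : SAW.DomainSAW D.carrier δ (a δ) (b δ) |
        (⟨γ.walk.toCurve (meshPoint δ)⟩ : Curve ℂ).HasTraversals (max k₁ k₂) x ρ R} = ∅ := by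
      refine Set.eq_empty_of_forall_notMem fun γ hγ => ?_
      have hk₂ : (⟨γ.walk.toCurve (meshPoint δ)⟩ : Curve ℂ).HasTraversals k₂ x ρ R :=
        hγ.of_le (le_max_right _ _)
      have hle := hasTraversals_toCurve_le (meshPoint δ) γ.walk hρR hk₂
      have htail : γ.walk.support.tail.length ≤ B.card :=
        length_support_tail_le hr hδ₁ hδ₁δ γ.walk γ.isPath
      omega
    rw [hempty, measure_empty]
    exact bot_le

/-- **(H1) for the critical SAW follows from eventual tightness of its laws**:
`EventualTight → SAWTraversalBound` (items stmt-CriticalPhenomena-1881 ⟹ 1880), by the quantile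
reduction and the shell-by-shell count tightness above. The converse is the route's glue item
`TraversalBoundTight` (stmt-1882, the tree's proved Aizenman–Burchard criterion), so the two items are
equivalent: (H1) as typed — free threshold `k(x, ρ, R)`, fixed `λ > 2` — is EXACTLY the open
precompactness problem for the critical planar SAW (Lawler–Schramm–Werner 2004, §3.4.2), for which no
annulus-crossing estimate exists in print. [folklore] -/
theorem sawTraversalBound_of_eventualTight (hT : EventualTight) : SAWTraversalBound :=
  sawTraversalBound_of_shellCountTight (shellCountTight_of_eventualTight hT)

/-- Given the route's glue `TraversalBoundTight : SAWTraversalBound → EventualTight` (stmt-1882),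
the items `SAWTraversalBound` (stmt-1880) and `EventualTight` (stmt-1881) are equivalent. [folklore] -/
theorem sawTraversalBound_iff_eventualTight_of_glue (hglue : TraversalBoundTight) :
    SAWTraversalBound ↔ EventualTight :=
  ⟨hglue, sawTraversalBound_of_eventualTight⟩

end Summit.CriticalPhenomena.SAWScalingLimit.Theorems

end
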